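import Literature.AlgebraicGeometry.ShimuraVarieties.UnitaryShimuraCurveWeakIdentification
import HarnessLib

/-!
# The identification `(M_K ⊗_L E′) ≅ X_K` of a curve record with a FAMILY of weak models is NATURAL: Hecke ∕ transition equivariance
# ([Deligne 1979] 2.2.6, 2.7.12; [Milne 2005] Thm. 13.6–13.7 — the GEN identification step of the P6a letter `stub_RGD`, (c1)-ready)

Topic `AlgebraicGeometry/ShimuraVarieties`, namespaces `…Motives` (§1, one generic lemma) and `…ShimuraVarieties.UnitaryCanonicalModel` (§2–§3).
THEOREMS ONLY (no definition, no instance, no notation, no named fact, no `sorry`).  Cell `hodgecm-mathlib` (D-0151), programme P6 «MOD» (crux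
hLiu418 = stmt-HodgeConjecture-24832, `--supports`).

★ `RecordSystemGS.exists_iso_baseChange_weakModel` (p846103) identifies `Y_K := (S.M K) ⊗_L E′` with one weak model `X` through SOME point
bijection `ptsY` of `Y_K`.  For the isogeny dictionary (P6c `PointDictionary.hecke`, field (c1)) the moduli side must read the RECORD՚s Hecke
translates `T_g : M_{N′} → M_{Kc}` through the identifications at TWO levels, i.e. it needs `(T_g ⊗ E′) ≫ φ_{Kc} = φ_{N′} ≫ T_g^X` for the moduli
Hecke morphism `T_g^X : X_{N′} → X_{Kc}`.  This file supplies exactly that: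
* §1 `Motives.apply_map_baseChange_eq_map_of_left_comp_fst` — point bijections `(X ⊗_k K)_{τ′}(ℂ) → X_τ(ℂ)` pinned by `(e P).left = P.left ≫ pr₁`
  (★ `exists_homeomorph_complexPoints_baseChange`) are NATURAL in the `k`-scheme (★ `baseChangeHom_map_left_comp_fst`).
* §2 `RecordSystemGS.exists_iso_baseChange_weakModel_pinned` — the one-level head again, now EXPOSING the pin `((S.pts K)⁻¹ (ptsY P)).left =
  P.left ≫ pr₁` of the point bijection `ptsY` (so `ptsY` is canonical: `P ↦ S.pts K (pr₁ ∘ P)`).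
* §3 `RecordSystemGS.exists_iso_baseChange_weakModel_natural` — for a FAMILY of levels `K_μ` and weak models `X_μ` (each (F1) smooth proper
  curve, (F2a) `ptsX_μ`, (F2c) pieces, (F3) weak reciprocity): identifications `φ_μ : Y_{K_μ} ≅ X_μ` and canonical `ptsY_μ` such that (i) each
  `ptsY_μ` satisfies (F3), (ii) `φ_μ` matches `ptsY_μ⁻¹[v,a] ↦ ptsX_μ⁻¹[v,a]`, (iii) `ptsY` is natural: `ptsY_ν ((T ⊗ E′)(ptsY_μ⁻¹ m)) =
  S.pts_ν (T ((S.pts_μ)⁻¹ m))` for EVERY `L`-morphism `T : M_{K_μ} → M_{K_ν}`, and (iv) EQUIVARIANCE: whenever `T` acts by `[v,a] ↦ [v,ag]` on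
  `S`՚s points and an `E′`-morphism `T^X : X_μ → X_ν` acts the same way on the `ptsX`, then `(T ⊗ E′) ≫ φ_ν = φ_μ ≫ T^X` (★
  `WeakRecordGS.hom_unique`).  With `T :=` ★ `recordHeckeTranslateGS` ∕ `S.M.map (homOfLE _)` this is the Hecke ∕ transition compatibility
  of the identification, [Deligne1979ShimuraVarieties] 2.7.12, [Milne2005ShimuraVarieties] Thm. 13.6.
HONEST LABEL: HC_CM is proved only modulo the 2 remaining named inputs (hLiu418 24832, h413 24833) until rung 0 closes; count-neutral capital.

## References
* [Deligne1979ShimuraVarieties] P. Deligne, *Variétés de Shimura* (1979), 2.2.4–2.2.6, 2.7.12.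
* [Milne2005ShimuraVarieties] J. S. Milne, *Introduction to Shimura varieties* (2005), Prop. 13.1 p. 117, Thm. 13.6 p. 118, Thm. 13.7 p. 119.
* [GortzWedhorn2020] U. Görtz, T. Wedhorn, *Algebraic Geometry I* (2nd ed. 2020), §(4.7)–(4.9), Prop. 4.16.
-/

set_option autoImplicit false

noncomputable section

open Function MulAction Topology NumberField IsDedekindDomain CategoryTheory CategoryTheory.Limits Matrix
  AlgebraicGeometry
open scoped Matrix ComplexOrder
open Literature.AlgebraicGeometry.Motives.AbelianVariety (bcSpec)

/-! ### §1. Pinned point bijections of a base change are natural in the scheme -/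

namespace Literature.AlgebraicGeometry.Motives

variable {k K : Type} [Field k] [Field K] [Algebra k K] {τ : k →+* ℂ} {τ' : K →+* ℂ}

/-- **Naturality of the pinned bijections `(X ⊗_k K)_{τ′}(ℂ) → X_τ(ℂ)`** ([GortzWedhorn2020] §(4.7)–(4.9)): if `e_X`, `e_{X′}` are point
maps pinned by `(e P).left = P.left ≫ pr₁` (as produced by ★ `exists_homeomorph_complexPoints_baseChange`), then for every `k`-morphism
`T : X ⟶ X′`, `e_{X′} ((T ⊗_k K) ∘ P) = T ∘ e_X P` — both underlying morphisms are `P ≫ pr₁ ≫ T` (★ `baseChangeHom_map_left_comp_fst`).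
[cite: GortzWedhorn2020, §(4.7)–(4.9) and Prop. 4.16] -/
theorem apply_map_baseChange_eq_map_of_left_comp_fst {X X' : SchemeOver k} (T : X ⟶ X')
    (e : (letI : Algebra K ℂ := τ'.toAlgebra; ComplexPoints ((baseChange k K).obj X)) →
        (letI : Algebra k ℂ := τ.toAlgebra; ComplexPoints X))
    (he : ∀ P, (e P).left = P.left ≫ pullback.fst X.hom (bcSpec k K))
    (e' : (letI : Algebra K ℂ := τ'.toAlgebra; ComplexPoints ((baseChange k K).obj X')) →
        (letI : Algebra k ℂ := τ.toAlgebra; ComplexPoints X'))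
    (he' : ∀ P, (e' P).left = P.left ≫ pullback.fst X'.hom (bcSpec k K))
    (P : letI : Algebra K ℂ := τ'.toAlgebra; ComplexPoints ((baseChange k K).obj X)) :
    letI : Algebra K ℂ := τ'.toAlgebra
    letI : Algebra k ℂ := τ.toAlgebra
    e' (AlgPoints.map ((baseChange k K).map T) P) = AlgPoints.map T (e P) := by
  letI : Algebra K ℂ := τ'.toAlgebra
  letI : Algebra k ℂ := τ.toAlgebra
  apply Over.OverMorphism.ext
  have h : ((baseChange k K).map T).left ≫ pullback.fst X'.hom (bcSpec k K) = pullback.fst X.hom (bcSpec k K) ≫ T.left :=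
    baseChangeHom_map_left_comp_fst (algebraMap k K) T
  change (e' (P ≫ (baseChange k K).map T)).left = (e P).left ≫ T.left
  rw [he', he]
  -- `(P ≫ T ⊗ K).left ≫ pr₁ = (P.left ≫ pr₁) ≫ T.left`, both `= P.left ≫ pr₁ ≫ T.left`
  exact (Category.assoc P.left ((baseChange k K).map T).left _).trans
    ((congrArg (fun x => P.left ≫ x) h).trans (Category.assoc _ _ _).symm)

end Literature.AlgebraicGeometry.Motives

open Literature.AlgebraicGeometry.Motives Literature.NumberTheory.Automorphic Literature.NumberTheory.Automorphic.UnitaryGroup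
open Literature.NumberTheory.Automorphic.Liu2021.AppendixC (C5.OpenCompactSubgroup C5.SmallLevel)
open Literature.NumberTheory.Automorphic.ShimuraDissection

namespace Literature.AlgebraicGeometry.ShimuraVarieties.UnitaryCanonicalModel

variable {L : Type} [Field L] [NumberField L] [IsCMField L] {Jstar : Matrix (Fin 2) (Fin 2) L} {τ : L →+* ℂ}
  {K₀ : C5.OpenCompactSubgroup ↥(finAdelic (↥(maximalRealSubfield L)) L (IsCMField.complexConj L) 2 Jstar)} {E : Type} [Field E] [NumberField E] [Algebra L E] {τE : E →+* ℂ}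

/-! ### §2. The one-level identification with the point bijection PINNED -/

omit [NumberField E] in
set_option maxHeartbeats 400000 in -- large adelic ∕ Shimura-set binder types (as ★ `UnitaryShimuraCurveRecordBaseChangeWeak`)
/-- **The base change of a curve record is a weak record — with the point bijection PINNED** ([Deligne1979ShimuraVarieties] 2.2.4–2.2.6): as ★
`RecordSystemGS.exists_weakRecord_baseChange` (p845986) — for `S : RecordSystemGS L J⋆ τ K₀`, `τ′ : E′ → ℂ` extending `τ` and a small level `K`,
the `E′`-scheme `Y := M_K ⊗_L E′` carries a point bijection `ptsY : Y_{τ′}(ℂ) ≃ₜ Sh_K(ℂ)` with (F3) weak reciprocity for `Aut(ℂ∕τ′E′)` and a bridge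
`gY : Y ⊗_{τ′} ℂ ≅ M_K ⊗_τ ℂ` carrying `bce_{τ′}(ptsY⁻¹[v,aK])` to `bce_τ((S.pts K)⁻¹[v,aK])` — AND `ptsY` is CANONICAL: `((S.pts K)⁻¹(ptsY P)).left =
P.left ≫ pr₁` (it is ★ `exists_homeomorph_complexPoints_baseChange`՚s pinned `e` followed by (F2a) `S.pts K`).
[cite: Deligne1979ShimuraVarieties, 2.2.4–2.2.6] [cite: Milne2005ShimuraVarieties, Def. 12.8 (62) p. 114; Thm. 13.7 p. 119] [cite: GortzWedhorn2020, Prop. 4.16] -/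
theorem RecordSystemGS.exists_weakRecord_baseChange_pinned (S : RecordSystemGS L Jstar τ K₀) (hτ : τE.comp (algebraMap L E) = τ)
    (K : C5.SmallLevel K₀) :
    letI : Algebra E ℂ := τE.toAlgebra
    ∃ ptsY : ComplexPoints ((Motives.baseChange L E).obj (S.M.obj K)) ≃ₜ ShimuraSetGS L Jstar τ K.1.1,
      (∀ (σ : ℂ ≃ₐ[E] ℂ) (s : (FiniteAdeleRing (𝓞 L) L)ˣ), IsArtinCorrespondent L τ s σ.toRingEquiv →
        ∀ (w : Fin 2 → L) (hw : (fun i => τ (w i)) ∈ negCone (Jstar.map τ)) (d : ↥(finAdelic (↥(maximalRealSubfield L)) L (IsCMField.complexConj L) 2 Jstar)),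
          IsDiagTwistGS L Jstar w (recipFactor L s) d →
          ∀ a : ↥(finAdelic (↥(maximalRealSubfield L)) L (IsCMField.complexConj L) 2 Jstar), σ • ptsY.symm (ShimuraSetGS.mk L Jstar τ K.1.1 (fun i => τ (w i)) hw a) =
            ptsY.symm (ShimuraSetGS.mk L Jstar τ K.1.1 (fun i => τ (w i)) hw (d * a))) ∧
      (∃ gY : (Motives.baseChangeHom τE).obj ((Motives.baseChange L E).obj (S.M.obj K)) ≅ (Motives.baseChangeHom τ).obj (S.M.obj K),
        ∀ (v : Fin 2 → ℂ) (hv : v ∈ negCone (Jstar.map τ)) (a : ↥(finAdelic (↥(maximalRealSubfield L)) L (IsCMField.complexConj L) 2 Jstar)),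
          AlgPoints.map gY.hom (AlgPoints.baseChangeEquiv τE ((Motives.baseChange L E).obj (S.M.obj K))
              (ptsY.symm (ShimuraSetGS.mk L Jstar τ K.1.1 v hv a))) =
            (letI : Algebra L ℂ := τ.toAlgebra
             AlgPoints.baseChangeEquiv τ (S.M.obj K) ((S.pts K).symm (ShimuraSetGS.mk L Jstar τ K.1.1 v hv a)))) ∧
      ∀ P : ComplexPoints ((Motives.baseChange L E).obj (S.M.obj K)),
        (letI : Algebra L ℂ := τ.toAlgebra; ((S.pts K).symm (ptsY P)).left) = P.left ≫ pullback.fst (S.M.obj K).hom (bcSpec L E) := by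
  letI iE : Algebra E ℂ := τE.toAlgebra
  letI iL : Algebra L ℂ := τ.toAlgebra
  haveI : IsScalarTower L E ℂ := IsScalarTower.of_algebraMap_eq fun x => (RingHom.congr_fun hτ x).symm
  haveI : IsProper (S.M.obj K).hom := (S.projective K).isProper
  obtain ⟨e, he₁, -, -⟩ := Motives.exists_homeomorph_complexPoints_baseChange hτ (S.M.obj K)
  obtain ⟨gY, -, -, hgY⟩ := Motives.exists_iso_baseChangeHom_baseChange hτ (S.M.obj K)
  refine ⟨e.trans (S.pts K), ?_, ⟨gY, fun v hv a => ?_⟩, fun P => ?_⟩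
  · intro σ s hs w hw d hd a
    -- reciprocity of `S` at `σ|_{τL}`, transported along the equivariant `e`
    have hs' : IsArtinCorrespondent L τ s (σ.restrictScalars L).toRingEquiv := hs
    have hrec := S.recip K (σ.restrictScalars L) s hs' w hw d hd a
    have hequiv := Motives.smul_eq_of_left_comp_fst hτ (S.M.obj K) e he₁ σ
      (e.symm ((S.pts K).symm (ShimuraSetGS.mk L Jstar τ K.1.1 (fun i => τ (w i)) hw a)))
    rw [Homeomorph.apply_symm_apply] at hequiv
    change σ • e.symm ((S.pts K).symm _) = e.symm ((S.pts K).symm _)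
    apply e.injective
    rw [hequiv, hrec, Homeomorph.apply_symm_apply]
  · change AlgPoints.map gY.hom (AlgPoints.baseChangeEquiv τE _ (e.symm ((S.pts K).symm _))) = _
    rw [hgY e he₁, Homeomorph.apply_symm_apply]
  · change ((S.pts K).symm (S.pts K (e P))).left = _
    rw [Homeomorph.symm_apply_apply, he₁]

set_option maxHeartbeats 400000 in -- large adelic ∕ Shimura-set binder types (as the ★ files it assembles)
/-- **Identification of a curve record with a weak model over `E′ ⊇ L`, point bijection pinned** ([Deligne1979ShimuraVarieties] 2.2.6,
[Milne2005ShimuraVarieties] Thm. 13.6–13.7, PROVED): as ★ `RecordSystemGS.exists_iso_baseChange_weakModel` — for `S : RecordSystemGS L J⋆ τ K₀`,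
`τ′ : E′ → ℂ` extending `τ`, a small level `K` and an `E′`-scheme `X`, smooth of relative dimension `1` and projective, with (F2a) `ptsX`, (F2c)
pieces of `X ⊗_{τ′} ℂ` and (F3) weak reciprocity, there are a point bijection `ptsY` of `Y := (S.M K) ⊗_L E′` satisfying (F3) and an
`E′`-isomorphism `φ : Y ≅ X` matching `ptsY⁻¹[v,aK] ↦ ptsX⁻¹[v,aK]` — AND `ptsY` is the CANONICAL bijection: `((S.pts K)⁻¹ (ptsY P)).left =
P.left ≫ pr₁` for every complex point `P` of `Y` along `τ′` (★ `exists_homeomorph_complexPoints_baseChange` then (F2a) `S.pts K`).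
[cite: Deligne1979ShimuraVarieties, 2.2.6 and 2.7.12] [cite: Milne2005ShimuraVarieties, Thm. 13.6 p. 118 and Thm. 13.7 p. 119] -/
theorem RecordSystemGS.exists_iso_baseChange_weakModel_pinned (S : RecordSystemGS L Jstar τ K₀) (hJ : (Jstar.map (IsCMField.complexConj L))ᵀ = Jstar)
    (hdet : IsUnit Jstar.det) (hτ : τE.comp (algebraMap L E) = τ) (K : C5.SmallLevel K₀)
    (X : SchemeOver E) [SmoothOfRelativeDimension 1 X.hom] (hX : IsProjectiveOver X)
    (ptsX : letI : Algebra E ℂ := τE.toAlgebra; ComplexPoints X ≃ₜ ShimuraSetGS L Jstar τ K.1.1)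
    (piecesX : letI : Algebra E ℂ := τE.toAlgebra
      (∃ (g : orbitRel.Quotient ↥(rational (↥(maximalRealSubfield L)) L (IsCMField.complexConj L) 2 Jstar)
          (CosetSpace (rationalToFinAdelic (↥(maximalRealSubfield L)) L (IsCMField.complexConj L) 2 Jstar) K.1.1) → ↥(finAdelic (↥(maximalRealSubfield L)) L (IsCMField.complexConj L) 2 Jstar))
      (_ : ∀ q, Quotient.mk'' (CosetSpace.pt (rationalToFinAdelic (↥(maximalRealSubfield L)) L (IsCMField.complexConj L) 2 Jstar) K.1.1 (g q)) = q)
      (Xp : orbitRel.Quotient ↥(rational (↥(maximalRealSubfield L)) L (IsCMField.complexConj L) 2 Jstar)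
          (CosetSpace (rationalToFinAdelic (↥(maximalRealSubfield L)) L (IsCMField.complexConj L) 2 Jstar) K.1.1) → SchemeOver ℂ)
      (ι : ∀ q, Xp q ⟶ ((Motives.baseChangeHom τE).obj X))
      (_ : Limits.IsColimit (Limits.Cofan.mk ((Motives.baseChangeHom τE).obj X) ι))
      (B : ∀ q, UnitaryBallUniformisationDatum 1 (Xp q)),
      ∀ q, (B q).Hℂ = Jstar.map τ ∧
        (B q).Γ.map (Matrix.GeneralLinearGroup.map ((B q).τ₁ : ↥(B q).E →+* ℂ)) =
          (arithmeticLevel (↥(maximalRealSubfield L)) L (IsCMField.complexConj L) 2 Jstar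
            (K.1.1.map (MulAut.conj (g q)).toMonoidHom)).map (Matrix.GeneralLinearGroup.map τ) ∧
        ∀ (v : Fin 2 → ℂ) (hv : v ∈ negCone (Jstar.map τ)),
          AlgPoints.map (ι q) ((B q).unif v) = (fun m => AlgPoints.baseChangeEquiv τE X (ptsX.symm m)) (ShimuraSetGS.mk L Jstar τ K.1.1 v hv (g q))))
    (recipX : letI : Algebra E ℂ := τE.toAlgebra
      ∀ (σ : ℂ ≃ₐ[E] ℂ) (s : (FiniteAdeleRing (𝓞 L) L)ˣ), IsArtinCorrespondent L τ s σ.toRingEquiv →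
        ∀ (w : Fin 2 → L) (hw : (fun i => τ (w i)) ∈ negCone (Jstar.map τ)) (d : ↥(finAdelic (↥(maximalRealSubfield L)) L (IsCMField.complexConj L) 2 Jstar)),
          IsDiagTwistGS L Jstar w (recipFactor L s) d →
          ∀ a : ↥(finAdelic (↥(maximalRealSubfield L)) L (IsCMField.complexConj L) 2 Jstar), σ • ptsX.symm (ShimuraSetGS.mk L Jstar τ K.1.1 (fun i => τ (w i)) hw a) =
            ptsX.symm (ShimuraSetGS.mk L Jstar τ K.1.1 (fun i => τ (w i)) hw (d * a))) :
    letI : Algebra E ℂ := τE.toAlgebra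
    ∃ (ptsY : ComplexPoints ((Motives.baseChange L E).obj (S.M.obj K)) ≃ₜ ShimuraSetGS L Jstar τ K.1.1)
      (φ : (Motives.baseChange L E).obj (S.M.obj K) ≅ X),
      (∀ (σ : ℂ ≃ₐ[E] ℂ) (s : (FiniteAdeleRing (𝓞 L) L)ˣ), IsArtinCorrespondent L τ s σ.toRingEquiv →
        ∀ (w : Fin 2 → L) (hw : (fun i => τ (w i)) ∈ negCone (Jstar.map τ)) (d : ↥(finAdelic (↥(maximalRealSubfield L)) L (IsCMField.complexConj L) 2 Jstar)),
          IsDiagTwistGS L Jstar w (recipFactor L s) d →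
          ∀ a : ↥(finAdelic (↥(maximalRealSubfield L)) L (IsCMField.complexConj L) 2 Jstar), σ • ptsY.symm (ShimuraSetGS.mk L Jstar τ K.1.1 (fun i => τ (w i)) hw a) =
            ptsY.symm (ShimuraSetGS.mk L Jstar τ K.1.1 (fun i => τ (w i)) hw (d * a))) ∧
      (∀ (v : Fin 2 → ℂ) (hv : v ∈ negCone (Jstar.map τ)) (a : ↥(finAdelic (↥(maximalRealSubfield L)) L (IsCMField.complexConj L) 2 Jstar)),
        ptsX (AlgPoints.map φ.hom (ptsY.symm (ShimuraSetGS.mk L Jstar τ K.1.1 v hv a))) = ShimuraSetGS.mk L Jstar τ K.1.1 v hv a) ∧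
      ∀ P : ComplexPoints ((Motives.baseChange L E).obj (S.M.obj K)),
        (letI : Algebra L ℂ := τ.toAlgebra; ((S.pts K).symm (ptsY P)).left) = P.left ≫ pullback.fst (S.M.obj K).hom (bcSpec L E) := by
  letI iE : Algebra E ℂ := τE.toAlgebra
  letI iL : Algebra L ℂ := τ.toAlgebra
  -- `Y := (S.M K) ⊗_L E′` is smooth of relative dimension 1 and projective
  haveI : SmoothOfRelativeDimension 1 (S.M.obj K).hom := S.smooth K
  haveI hYs : SmoothOfRelativeDimension 1 ((Motives.baseChange L E).obj (S.M.obj K)).hom :=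
    HodgeTheory.smoothOfRelativeDimension_baseChangeHom_hom (algebraMap L E) 1 (S.M.obj K)
  have hY : IsProjectiveOver ((Motives.baseChange L E).obj (S.M.obj K)) := (S.projective K).baseChange_obj E
  -- BC (pinned): the weak record structure of `Y`, the bridge to `S`՚s complex fibre, the pin
  obtain ⟨ptsY, recipY, ⟨gY, hgY⟩, hpin⟩ := S.exists_weakRecord_baseChange_pinned hτ K
  -- PIECES: `gc : Y_ℂ ≅ X_ℂ`; UNIQ-WEAK: descent to `E′`
  obtain ⟨gc, hgc⟩ := S.exists_complexIso_weak K X hX ptsX piecesX ptsY gY hgY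
  obtain ⟨φ, hφ⟩ := WeakRecordGS.exists_iso_of_complexIso hτ K.1.1 X ((Motives.baseChange L E).obj (S.M.obj K)) hX hY
    ptsX ptsY recipX recipY gc hgc hJ hdet
  exact ⟨ptsY, φ, recipY, hφ, hpin⟩

/-! ### §3. A family of levels: canonical point bijections, identifications, naturality and Hecke ∕ transition equivariance -/

set_option maxHeartbeats 400000 in -- large adelic ∕ Shimura-set binder types (as the ★ files it assembles)
/-- **The identifications `(S.M K_μ) ⊗_L E′ ≅ X_μ` of a curve record with a family of weak models are natural** ([Deligne1979ShimuraVarieties]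
2.2.6, 2.7.12; [Milne2005ShimuraVarieties] Thm. 13.6–13.7, PROVED).  Data: `S : RecordSystemGS L J⋆ τ K₀` (`J⋆` hermitian, `det J⋆ ≠ 0`),
`τ′ : E′ → ℂ` extending `τ`, an index type `Λ`, small levels `K_μ`, `E′`-schemes `X_μ` smooth of relative dimension `1` and projective with
(F2a) `ptsX_μ : X_μ(ℂ) ≃ₜ Sh_{K_μ}(ℂ)`, (F2c) pieces of `X_μ ⊗_{τ′} ℂ`, (F3) weak reciprocity.  Conclusion: point bijections `ptsY_μ` of
`Y_μ := (S.M K_μ) ⊗_L E′` and `E′`-isomorphisms `φ_μ : Y_μ ≅ X_μ` with (i) (F3) for every `ptsY_μ`; (ii) `ptsX_μ (φ_μ (ptsY_μ⁻¹[v,a])) = [v,a]`;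
(iii) NATURALITY of `ptsY`: for every `L`-morphism `T : S.M K_μ ⟶ S.M K_ν` and `m`, `ptsY_ν ((T ⊗ E′)(ptsY_μ⁻¹ m)) = S.pts_ν (T (S.pts_μ⁻¹ m))`;
(iv) EQUIVARIANCE: if `T` acts by `[v,a] ↦ [v,ag]` on `S`՚s complex points and an `E′`-morphism `T^X : X_μ ⟶ X_ν` acts by `[v,a] ↦ [v,ag]`
on the `ptsX`, then `(T ⊗_L E′) ≫ φ_ν = φ_μ ≫ T^X` (both composites send `ptsY_μ⁻¹[v,a]` to `ptsX_ν⁻¹[v,ag]`; ★ `WeakRecordGS.hom_unique`).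
For `T` a record Hecke translate (★ `recordHeckeTranslateGS`, `g` its element) resp. a transition map (`g = 1`) this is the Hecke ∕ tower
compatibility of the identification that the isogeny dictionary՚s field (c1) consumes.
[cite: Deligne1979ShimuraVarieties, 2.2.6 and 2.7.12] [cite: Milne2005ShimuraVarieties, Thm. 13.6 p. 118 and Thm. 13.7 p. 119] -/
theorem RecordSystemGS.exists_iso_baseChange_weakModel_natural (S : RecordSystemGS L Jstar τ K₀) (hJ : (Jstar.map (IsCMField.complexConj L))ᵀ = Jstar)
    (hdet : IsUnit Jstar.det) (hτ : τE.comp (algebraMap L E) = τ) {Λ : Type*} (K : Λ → C5.SmallLevel K₀)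
    (X : Λ → SchemeOver E) [∀ μ, SmoothOfRelativeDimension 1 (X μ).hom] (hX : ∀ μ, IsProjectiveOver (X μ))
    (ptsX : letI : Algebra E ℂ := τE.toAlgebra; ∀ μ, ComplexPoints (X μ) ≃ₜ ShimuraSetGS L Jstar τ (K μ).1.1)
    (piecesX : letI : Algebra E ℂ := τE.toAlgebra
      ∀ μ, (∃ (g : orbitRel.Quotient ↥(rational (↥(maximalRealSubfield L)) L (IsCMField.complexConj L) 2 Jstar)
          (CosetSpace (rationalToFinAdelic (↥(maximalRealSubfield L)) L (IsCMField.complexConj L) 2 Jstar) (K μ).1.1) → ↥(finAdelic (↥(maximalRealSubfield L)) L (IsCMField.complexConj L) 2 Jstar))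
      (_ : ∀ q, Quotient.mk'' (CosetSpace.pt (rationalToFinAdelic (↥(maximalRealSubfield L)) L (IsCMField.complexConj L) 2 Jstar) (K μ).1.1 (g q)) = q)
      (Xp : orbitRel.Quotient ↥(rational (↥(maximalRealSubfield L)) L (IsCMField.complexConj L) 2 Jstar)
          (CosetSpace (rationalToFinAdelic (↥(maximalRealSubfield L)) L (IsCMField.complexConj L) 2 Jstar) (K μ).1.1) → SchemeOver ℂ)
      (ι : ∀ q, Xp q ⟶ ((Motives.baseChangeHom τE).obj (X μ)))
      (_ : Limits.IsColimit (Limits.Cofan.mk ((Motives.baseChangeHom τE).obj (X μ)) ι))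
      (B : ∀ q, UnitaryBallUniformisationDatum 1 (Xp q)),
      ∀ q, (B q).Hℂ = Jstar.map τ ∧
        (B q).Γ.map (Matrix.GeneralLinearGroup.map ((B q).τ₁ : ↥(B q).E →+* ℂ)) =
          (arithmeticLevel (↥(maximalRealSubfield L)) L (IsCMField.complexConj L) 2 Jstar
            ((K μ).1.1.map (MulAut.conj (g q)).toMonoidHom)).map (Matrix.GeneralLinearGroup.map τ) ∧
        ∀ (v : Fin 2 → ℂ) (hv : v ∈ negCone (Jstar.map τ)),
          AlgPoints.map (ι q) ((B q).unif v) = (fun m => AlgPoints.baseChangeEquiv τE (X μ) ((ptsX μ).symm m)) (ShimuraSetGS.mk L Jstar τ (K μ).1.1 v hv (g q))))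
    (recipX : letI : Algebra E ℂ := τE.toAlgebra
      ∀ μ, ∀ (σ : ℂ ≃ₐ[E] ℂ) (s : (FiniteAdeleRing (𝓞 L) L)ˣ), IsArtinCorrespondent L τ s σ.toRingEquiv →
        ∀ (w : Fin 2 → L) (hw : (fun i => τ (w i)) ∈ negCone (Jstar.map τ)) (d : ↥(finAdelic (↥(maximalRealSubfield L)) L (IsCMField.complexConj L) 2 Jstar)),
          IsDiagTwistGS L Jstar w (recipFactor L s) d →
          ∀ a : ↥(finAdelic (↥(maximalRealSubfield L)) L (IsCMField.complexConj L) 2 Jstar), σ • (ptsX μ).symm (ShimuraSetGS.mk L Jstar τ (K μ).1.1 (fun i => τ (w i)) hw a) =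
            (ptsX μ).symm (ShimuraSetGS.mk L Jstar τ (K μ).1.1 (fun i => τ (w i)) hw (d * a))) :
    letI : Algebra E ℂ := τE.toAlgebra
    ∃ (ptsY : ∀ μ, ComplexPoints ((Motives.baseChange L E).obj (S.M.obj (K μ))) ≃ₜ ShimuraSetGS L Jstar τ (K μ).1.1)
      (φ : ∀ μ, (Motives.baseChange L E).obj (S.M.obj (K μ)) ≅ X μ),
      (∀ μ, ∀ (σ : ℂ ≃ₐ[E] ℂ) (s : (FiniteAdeleRing (𝓞 L) L)ˣ), IsArtinCorrespondent L τ s σ.toRingEquiv →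
        ∀ (w : Fin 2 → L) (hw : (fun i => τ (w i)) ∈ negCone (Jstar.map τ)) (d : ↥(finAdelic (↥(maximalRealSubfield L)) L (IsCMField.complexConj L) 2 Jstar)),
          IsDiagTwistGS L Jstar w (recipFactor L s) d →
          ∀ a : ↥(finAdelic (↥(maximalRealSubfield L)) L (IsCMField.complexConj L) 2 Jstar), σ • (ptsY μ).symm (ShimuraSetGS.mk L Jstar τ (K μ).1.1 (fun i => τ (w i)) hw a) =
            (ptsY μ).symm (ShimuraSetGS.mk L Jstar τ (K μ).1.1 (fun i => τ (w i)) hw (d * a))) ∧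
      (∀ μ (v : Fin 2 → ℂ) (hv : v ∈ negCone (Jstar.map τ)) (a : ↥(finAdelic (↥(maximalRealSubfield L)) L (IsCMField.complexConj L) 2 Jstar)),
        ptsX μ (AlgPoints.map (φ μ).hom ((ptsY μ).symm (ShimuraSetGS.mk L Jstar τ (K μ).1.1 v hv a))) =
          ShimuraSetGS.mk L Jstar τ (K μ).1.1 v hv a) ∧
      (∀ μ ν (T : S.M.obj (K μ) ⟶ S.M.obj (K ν)) (m : ShimuraSetGS L Jstar τ (K μ).1.1),
        ptsY ν (AlgPoints.map ((Motives.baseChange L E).map T) ((ptsY μ).symm m)) =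
          (letI : Algebra L ℂ := τ.toAlgebra; S.pts (K ν) (AlgPoints.map T ((S.pts (K μ)).symm m)))) ∧
      ∀ μ ν (g : ↥(finAdelic (↥(maximalRealSubfield L)) L (IsCMField.complexConj L) 2 Jstar)) (T : S.M.obj (K μ) ⟶ S.M.obj (K ν)),
        (letI : Algebra L ℂ := τ.toAlgebra
         ∀ (v : Fin 2 → ℂ) (hv : v ∈ negCone (Jstar.map τ)) (a : ↥(finAdelic (↥(maximalRealSubfield L)) L (IsCMField.complexConj L) 2 Jstar)),
           S.pts (K ν) (AlgPoints.map T ((S.pts (K μ)).symm (ShimuraSetGS.mk L Jstar τ (K μ).1.1 v hv a))) =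
             ShimuraSetGS.mk L Jstar τ (K ν).1.1 v hv (a * g)) →
        ∀ TX : X μ ⟶ X ν,
          (∀ (v : Fin 2 → ℂ) (hv : v ∈ negCone (Jstar.map τ)) (a : ↥(finAdelic (↥(maximalRealSubfield L)) L (IsCMField.complexConj L) 2 Jstar)),
             ptsX ν (AlgPoints.map TX ((ptsX μ).symm (ShimuraSetGS.mk L Jstar τ (K μ).1.1 v hv a))) =
               ShimuraSetGS.mk L Jstar τ (K ν).1.1 v hv (a * g)) →
          (Motives.baseChange L E).map T ≫ (φ ν).hom = (φ μ).hom ≫ TX := by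
  letI iE : Algebra E ℂ := τE.toAlgebra
  letI iL : Algebra L ℂ := τ.toAlgebra
  haveI hYs : ∀ μ, SmoothOfRelativeDimension 1 ((Motives.baseChange L E).obj (S.M.obj (K μ))).hom := fun μ =>
    haveI : SmoothOfRelativeDimension 1 (S.M.obj (K μ)).hom := S.smooth (K μ)
    HodgeTheory.smoothOfRelativeDimension_baseChangeHom_hom (algebraMap L E) 1 (S.M.obj (K μ))
  -- one level at a time (§2), then choice over the family
  have h1 := fun μ => S.exists_iso_baseChange_weakModel_pinned hJ hdet hτ (K μ) (X μ) (hX μ) (ptsX μ) (piecesX μ) (recipX μ)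
  choose ptsY φ hrecip hφ hpin using h1
  -- (iii) naturality of the canonical `ptsY` (§1 with `e_μ := (S.pts K_μ)⁻¹ ∘ ptsY_μ`)
  have hnat : ∀ μ ν (T : S.M.obj (K μ) ⟶ S.M.obj (K ν)) (m : ShimuraSetGS L Jstar τ (K μ).1.1),
      ptsY ν (AlgPoints.map ((Motives.baseChange L E).map T) ((ptsY μ).symm m)) =
        S.pts (K ν) (AlgPoints.map T ((S.pts (K μ)).symm m)) := by
    intro μ ν T m
    have h := Motives.apply_map_baseChange_eq_map_of_left_comp_fst (τ := τ) (τ' := τE) T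
      (fun P => (S.pts (K μ)).symm (ptsY μ P)) (hpin μ) (fun P => (S.pts (K ν)).symm (ptsY ν P)) (hpin ν) ((ptsY μ).symm m)
    rw [Homeomorph.apply_symm_apply] at h
    rw [← (S.pts (K ν)).apply_symm_apply (ptsY ν _), h]
  refine ⟨ptsY, φ, hrecip, hφ, hnat, fun μ ν g T hT TX hTX => ?_⟩
  -- (iv) both composites send `ptsY_μ⁻¹[v,a]` to `ptsX_ν⁻¹[v,ag]`
  refine WeakRecordGS.hom_unique (K μ).1.1 (K ν).1.1 (X ν) ((Motives.baseChange L E).obj (S.M.obj (K μ))) (hX ν) (ptsX ν) (ptsY μ) g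
    (fun v hv a => ?_) (fun v hv a => ?_)
  · have hstep : AlgPoints.map ((Motives.baseChange L E).map T) ((ptsY μ).symm (ShimuraSetGS.mk L Jstar τ (K μ).1.1 v hv a)) =
        (ptsY ν).symm (ShimuraSetGS.mk L Jstar τ (K ν).1.1 v hv (a * g)) :=
      (ptsY ν).injective (by rw [hnat, hT, Homeomorph.apply_symm_apply])
    rw [AlgPoints.map_comp_apply, hstep, hφ]
  · have hstep : AlgPoints.map (φ μ).hom ((ptsY μ).symm (ShimuraSetGS.mk L Jstar τ (K μ).1.1 v hv a)) =
        (ptsX μ).symm (ShimuraSetGS.mk L Jstar τ (K μ).1.1 v hv a) :=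
      (ptsX μ).injective (by rw [hφ, Homeomorph.apply_symm_apply])
    rw [AlgPoints.map_comp_apply, hstep, hTX]

end Literature.AlgebraicGeometry.ShimuraVarieties.UnitaryCanonicalModel

end
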